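import Mathlib

/-!
# N4a (`𝔸ⁿ/(J₃ ⊕ J₂)`, `p ≥ 3`) — K1/K2 algebra: the augmentation ideal over the two K–L charts
# `D₊(x_b² t)` and `D₊(x_d² t)` of `Bl_{(x_a, x_b², x_bx_d, x_d²)} 𝔸ⁿ` is principal, in ANY Rees chart

(crux stmt-ResolutionOfSingularities-15640 `WildQuotients.WildQuotientResolution`, line `Sketch`;
post-V5 width target N4a `JordanThreeTwo.jordanThreeTwo_hasResolution` (res-L1-w45c-idea-2 card N,
res-L1-w45c-plan-1 R-LANE RULING 2026-08-27T14:12:52Z (2), res-L1-w45c-stub-2 file plan 14:24:14Z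
«K1/K2 the two K–L chart algebras (stalk augmentation ideal principal)»; plan-1 15:02:37Z/15:03:39Z
«stub-3 → N4a K1/K2»). The `J₃ ⊕ J₂` twin of `JordanFive.chartD_span_eq` / `I12.chart_span_eq`
(res-L1-w45c-stub-3, …JordanFiveChartDAug). [OURS · L1 W4.5c] — NOT a statement of any manuscript;
replaces the role of no printed item. Pure commutative algebra, def-free.)

SETTING. A domain `S` (a stalk of the blow-up), `xa xb xd ∈ S`, a ring endomorphism `a` of
`J₃ ⊕ J₂`-type on these slots — `a xa = xa`, `a xb = xb + m·xa`, `a xd = xd` (every `g = σⁱ` acts so;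
`x_c ↦ x_c + m x_b + m′ x_a`, `x_e ↦ x_e + m x_d` are moves inside `(xa, xb, xd)` and play no role) —
and the centre generators `K = (xa, xb², xb·xd, xd²)` (`![xa, xb^2, xb*xd, xd^2]`, res-L1-w45c-stub-2's
letters), `T = K_j ≠ 0`, `T·U_l = K_l` the Rees-chart relations. The ideal
`(xa, xb, xd) + (a U_l − U_l : l ≠ j)` — the augmentation ideal of the stalk action, by
`JordanThree.span_sub_eq_map_sup_span_of_chart` and `I_{σⁱ} = (x_a, x_b, x_d)` — is

* `JordanThreeTwo.chart_span_eq_of_mem_sq_b` — `= (xb)` whenever every `K_l ∈ (xb²)` (the point lies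
  over `D₊(x_b² t)`): `xa = u·xb²`, `xd = w·xb`, `a` multiplies `T` by the square of
  `v = 1 + m·u·xb ≡ 1 (mod xb)`;
* `JordanThreeTwo.chart_span_eq_of_mem_sq_d` — `= (xd)` whenever every `K_l ∈ (xd²)` (over
  `D₊(x_d² t)`): `a` FIXES `T`, `a U₂ = U₂ + m·U₀·xd`, `a U₁ = (U₂ + m U₀ xd)²`;
* `…_isPrincipal` corollaries — the Király–Lütkebohmert input on the two divisorial pieces.
-/

-- single-problem summit: the doubled namespace component `ResolutionOfSingularities` is forced
set_option linter.dupNamespace false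

noncomputable section

namespace Summit.ResolutionOfSingularities.ResolutionOfSingularities.Theorems.WildQuotientResolution.JordanThreeTwo

variable {S : Type} [CommRing S] [IsDomain S] (xa xb xd T m : S) (K U : Fin 4 → S)
  (hK : ∀ l, K l = (![xa, xb ^ 2, xb * xd, xd ^ 2] : Fin 4 → S) l)
  (a : S →+* S) (ha : a xa = xa) (hb : a xb = xb + m * xa) (hd : a xd = xd)
  (hT : T ≠ 0) (j : Fin 4) (hTj : T = K j) (hU : ∀ l, T * U l = K l)

include hK ha hb hd hT hTj hU in
/-- **Over `D₊(x_b² t)` the augmentation ideal is `(x_b)`** (any characteristic, any `m`): in a domain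
`S` with a `J₃ ⊕ J₂`-type endomorphism `a` (`a xa = xa`, `a xb = xb + m xa`, `a xd = xd`), Rees-chart
relations `T·U_l = K_l` (`T = K_j ≠ 0`) for `K = (xa, xb², xb·xd, xd²)`, if every `K_l ∈ (xb²)` then
`(xa, xb, xd) + (a U_l − U_l : l ≠ j) = (xb)`. [OURS · L1 W4.5c] [folklore] -/
theorem chart_span_eq_of_mem_sq_b (hmem : ∀ l, K l ∈ Ideal.span ({xb ^ 2} : Set S)) :
    Ideal.span ({xa, xb, xd} : Set S) ⊔
      Ideal.span (Set.range fun l : {l : Fin 4 // l ≠ j} => a (U l) - U l) =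
      Ideal.span ({xb} : Set S) := by
  classical
  have hK0 : K 0 = xa := by rw [hK]; rfl
  have hK1 : K 1 = xb ^ 2 := by rw [hK]; rfl
  have hK2 : K 2 = xb * xd := by rw [hK]; rfl
  have hK3 : K 3 = xd ^ 2 := by rw [hK]; rfl
  -- `xa = u xb²`, `xb xd = w' xb²` hence `xd = w' xb`
  obtain ⟨u, hu⟩ := Ideal.mem_span_singleton'.mp (hmem 0)
  obtain ⟨w, hw⟩ := Ideal.mem_span_singleton'.mp (hmem 2)
  rw [hK0] at hu
  rw [hK2] at hw
  have hxb : xb ≠ 0 := by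
    intro h0
    apply hT
    obtain ⟨q, hq⟩ := Ideal.mem_span_singleton'.mp (hmem j)
    rw [hTj, ← hq, h0]; ring
  have hxd : xd = w * xb := by
    have h : (xd - w * xb) * xb = 0 := by linear_combination hw.symm
    rcases mul_eq_zero.mp h with h | h
    · linear_combination h
    · exact absurd h hxb
  -- the multiplier `v = 1 + m u xb`: `a xb = v xb`
  have hab : a xb = (1 + m * u * xb) * xb := by rw [hb, ← hu]; ring
  have hv1 : (1 + m * u * xb) - 1 ∈ Ideal.span ({xb} : Set S) :=
    Ideal.mem_span_singleton'.mpr ⟨m * u, by ring⟩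
  -- `a (K l) = v^{β+δ} K l` with `β + δ = 2` for `l ≠ 0`, and `a (K 0) = K 0`
  have hl4 : ∀ l : Fin 4, l = 0 ∨ l = 1 ∨ l = 2 ∨ l = 3 := by decide
  have haK : ∀ l : Fin 4, ∃ c : S, a (K l) = c * K l ∧ c - 1 ∈ Ideal.span ({xb} : Set S) := by
    intro l
    rcases hl4 l with rfl | rfl | rfl | rfl
    · exact ⟨1, by rw [hK0, ha, one_mul], by rw [sub_self]; exact zero_mem _⟩
    · refine ⟨(1 + m * u * xb) ^ 2, by rw [hK1, map_pow, hab]; ring, ?_⟩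
      have : (1 + m * u * xb) ^ 2 - 1 = ((1 + m * u * xb) + 1) * ((1 + m * u * xb) - 1) := by ring
      rw [this]; exact Ideal.mul_mem_left _ _ hv1
    · exact ⟨1 + m * u * xb, by rw [hK2, map_mul, hab, hd]; ring, hv1⟩
    · exact ⟨1, by rw [hK3, map_pow, hd, one_mul], by rw [sub_self]; exact zero_mem _⟩
  obtain ⟨cT, hcT, hcT1⟩ := haK j
  apply le_antisymm
  · refine sup_le ?_ ?_
    · rw [Ideal.span_le]
      intro x hx
      simp only [Set.mem_insert_iff, Set.mem_singleton_iff] at hx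
      rcases hx with rfl | rfl | rfl
      · exact Ideal.mem_span_singleton'.mpr ⟨u * xb, by rw [← hu]; ring⟩
      · exact Ideal.mem_span_singleton_self _
      · exact Ideal.mem_span_singleton'.mpr ⟨w, hxd.symm⟩
    · rw [Ideal.span_le]
      rintro _ ⟨⟨l, hlj⟩, rfl⟩
      obtain ⟨cl, hcl, hcl1⟩ := haK l
      -- `T · (a U_l) · cT = cl · T · U_l`, cancel `T`
      have h1 : a T * a (U l) = cl * (T * U l) := by rw [← map_mul, hU, hcl]
      rw [hTj, hcT, ← hTj] at h1
      -- `cT * a (U l) = cl * U l`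
      have h2 : cT * a (U l) = cl * U l := by
        have : T * (cT * a (U l) - cl * U l) = 0 := by linear_combination h1
        rcases mul_eq_zero.mp this with h | h
        · exact absurd h hT
        · linear_combination h
      -- `a U - U = (1 - cT) a U + (cl - 1) U`
      have e : a (U l) - U l = -(cT - 1) * a (U l) + (cl - 1) * U l := by linear_combination h2
      change a (U l) - U l ∈ Ideal.span ({xb} : Set S)
      rw [e]
      exact Ideal.add_mem _ (Ideal.mul_mem_right _ _ (neg_mem hcT1))
        (Ideal.mul_mem_right _ _ hcl1)
  · rw [Ideal.span_singleton_le_iff_mem]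
    exact Ideal.mem_sup_left (Ideal.subset_span (by simp))

include hK ha hb hd hT hTj hU in
/-- **Over `D₊(x_d² t)` the augmentation ideal is `(x_d)`** (any characteristic, any `m`): with the
data of `chart_span_eq_of_mem_sq_b`, if every `K_l ∈ (xd²)` then
`(xa, xb, xd) + (a U_l − U_l : l ≠ j) = (xd)` — here `a T = T`, `a U₀ = U₀`, `a U₂ = U₂ + m U₀ xd`,
`a U₁ = (U₂ + m U₀ xd)·(…)`. [OURS · L1 W4.5c] [folklore] -/
theorem chart_span_eq_of_mem_sq_d (hmem : ∀ l, K l ∈ Ideal.span ({xd ^ 2} : Set S)) :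
    Ideal.span ({xa, xb, xd} : Set S) ⊔
      Ideal.span (Set.range fun l : {l : Fin 4 // l ≠ j} => a (U l) - U l) =
      Ideal.span ({xd} : Set S) := by
  classical
  have hK0 : K 0 = xa := by rw [hK]; rfl
  have hK1 : K 1 = xb ^ 2 := by rw [hK]; rfl
  have hK2 : K 2 = xb * xd := by rw [hK]; rfl
  have hK3 : K 3 = xd ^ 2 := by rw [hK]; rfl
  obtain ⟨u, hu⟩ := Ideal.mem_span_singleton'.mp (hmem 0)
  obtain ⟨w, hw⟩ := Ideal.mem_span_singleton'.mp (hmem 2)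
  rw [hK0] at hu
  rw [hK2] at hw
  have hxd : xd ≠ 0 := by
    intro h0
    apply hT
    obtain ⟨q, hq⟩ := Ideal.mem_span_singleton'.mp (hmem j)
    rw [hTj, ← hq, h0]; ring
  have hxb : xb = w * xd := by
    have h : (xb - w * xd) * xd = 0 := by linear_combination hw.symm
    rcases mul_eq_zero.mp h with h | h
    · linear_combination h
    · exact absurd h hxd
  -- `a` fixes `T` (every `K_l` moves inside `K_l + (xd)·…` and `a K_j`: compute directly)
  -- moves of the generators: `a (K l) - K l = xd * (T-multiple)`-free form: `a K_l - K_l ∈ xd² · (…)`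
  have hl4 : ∀ l : Fin 4, l = 0 ∨ l = 1 ∨ l = 2 ∨ l = 3 := by decide
  have haK : ∀ l : Fin 4, ∃ c : S, a (K l) = K l + c * (u * xd) * xd ^ 2 := by
    intro l
    rcases hl4 l with rfl | rfl | rfl | rfl
    · exact ⟨0, by rw [hK0, ha]; ring⟩
    · exact ⟨2 * m * w + m ^ 2 * (u * xd), by rw [hK1, map_pow, hb, ← hu, hxb]; ring⟩
    · exact ⟨m, by rw [hK2, map_mul, hb, hd, ← hu]; ring⟩
    · exact ⟨0, by rw [hK3, map_pow, hd]; ring⟩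
  -- `T = q xd²`
  obtain ⟨q, hq⟩ := Ideal.mem_span_singleton'.mp (hmem j)
  rw [← hTj] at hq
  obtain ⟨cT, hcT⟩ := haK j
  rw [← hTj] at hcT
  apply le_antisymm
  · refine sup_le ?_ ?_
    · rw [Ideal.span_le]
      intro x hx
      simp only [Set.mem_insert_iff, Set.mem_singleton_iff] at hx
      rcases hx with rfl | rfl | rfl
      · exact Ideal.mem_span_singleton'.mpr ⟨u * xd, by rw [← hu]; ring⟩
      · exact Ideal.mem_span_singleton'.mpr ⟨w, hxb.symm⟩
      · exact Ideal.mem_span_singleton_self _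
    · rw [Ideal.span_le]
      rintro _ ⟨⟨l, hlj⟩, rfl⟩
      obtain ⟨cl, hcl⟩ := haK l
      -- `a T · a U_l = a K_l`: `(T + cT u xd·xd²) a U_l = T U_l + cl u xd · xd²`, and `xd² = T/q`…
      -- cancel `T = q xd²` (so `xd² ∣ T`): write everything as multiples of `xd²`
      have h1 : a T * a (U l) = K l + cl * (u * xd) * xd ^ 2 := by rw [← map_mul, hU, hcl]
      rw [hcT, ← hU l, ← hq] at h1
      -- h1 : (q xd² + cT u xd xd²) aU = q xd² U + cl u xd xd²
      have h2 : (q + cT * (u * xd)) * a (U l) = q * U l + cl * (u * xd) := by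
        have : xd ^ 2 * ((q + cT * (u * xd)) * a (U l) - (q * U l + cl * (u * xd))) = 0 := by
          linear_combination h1
        rcases mul_eq_zero.mp this with h | h
        · exact absurd h (pow_ne_zero 2 hxd)
        · linear_combination h
      -- `q` is a unit: `T · U 3 = xd²` and `T = q xd²` give `q · U 3 = 1`
      have hqU3 : q * U 3 = 1 := by
        have h := hU 3
        rw [hK3, ← hq] at h
        have : xd ^ 2 * (q * U 3 - 1) = 0 := by linear_combination h
        rcases mul_eq_zero.mp this with h' | h'
        · exact absurd h' (pow_ne_zero 2 hxd)
        · linear_combination h'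
      -- `q (aU - U) = xd · (cl u - cT u aU)`
      have e : q * (a (U l) - U l) = xd * (cl * u - cT * u * a (U l)) := by linear_combination h2
      have e2 : a (U l) - U l = U 3 * (xd * (cl * u - cT * u * a (U l))) := by
        have h3 : a (U l) - U l = (q * U 3) * (a (U l) - U l) := by rw [hqU3, one_mul]
        rw [h3, mul_comm q (U 3), mul_assoc, e]
      change a (U l) - U l ∈ Ideal.span ({xd} : Set S)
      rw [e2]
      exact Ideal.mul_mem_left _ _ (Ideal.mul_mem_right _ _ (Ideal.mem_span_singleton_self xd))
  · rw [Ideal.span_singleton_le_iff_mem]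
    exact Ideal.mem_sup_left (Ideal.subset_span (by simp))

include hK ha hb hd hT hTj hU in
/-- **Corollary (K1): over `D₊(x_b² t)` the augmentation ideal of the stalk action is principal.**
[OURS · L1 W4.5c] [folklore] -/
theorem chart_isPrincipal_of_mem_sq_b (hmem : ∀ l, K l ∈ Ideal.span ({xb ^ 2} : Set S)) :
    (Ideal.span ({xa, xb, xd} : Set S) ⊔
      Ideal.span (Set.range fun l : {l : Fin 4 // l ≠ j} => a (U l) - U l)).IsPrincipal := by
  rw [chart_span_eq_of_mem_sq_b xa xb xd T m K U hK a ha hb hd hT j hTj hU hmem]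
  exact ⟨⟨xb, rfl⟩⟩

include hK ha hb hd hT hTj hU in
/-- **Corollary (K2): over `D₊(x_d² t)` the augmentation ideal of the stalk action is principal.**
[OURS · L1 W4.5c] [folklore] -/
theorem chart_isPrincipal_of_mem_sq_d (hmem : ∀ l, K l ∈ Ideal.span ({xd ^ 2} : Set S)) :
    (Ideal.span ({xa, xb, xd} : Set S) ⊔
      Ideal.span (Set.range fun l : {l : Fin 4 // l ≠ j} => a (U l) - U l)).IsPrincipal := by
  rw [chart_span_eq_of_mem_sq_d xa xb xd T m K U hK a ha hb hd hT j hTj hU hmem]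
  exact ⟨⟨xd, rfl⟩⟩

end Summit.ResolutionOfSingularities.ResolutionOfSingularities.Theorems.WildQuotientResolution.JordanThreeTwo

end
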